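/-
Copyright (c) 2026 the pub-hodgecm-mathlib formalisation cell (harness21).  Prover seat hodgecm-mathlib-LH4-p09 (g11) (Track A hand on the K2 lane, second hand of
LH4-p14 (g9)'s (dec-2-pay) F2 package), Track B «K2-LIT» ∕ hLiu418 #184♮, socket #41 KIND 1, package (K1b-♮), letter (dec-2-pay) — F2α «LINE EULER AT THE
CORNER-TRANSLATE» (LH4-p14 (g9) CENSUS-F2-hchain1 (M0)–(M4), deal 2026-09-05T04:00:41Z).  THEOREMS ONLY (no `def`, no `instance`, no notation, no named-fact hypothesis, no `sorry`).
-/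
import Summits.HodgeConjecture.HodgeConjecture.Theorems.K2LiuKindOneLineWhittakerEuler        -- ★ (KW1-b) p862675 `whittakerDelta_eq_kindWPart_mul_line` (+ ★ (x-a) `kindWPlaces`, `kindWFinset`, `kindWPart`)
import Summits.HodgeConjecture.HodgeConjecture.Theorems.K2LiuKindOneLineGoodPlaceFactor       -- ★ (KW1-b2) `integral_conj_unipDeltaChar_mul_lambdaLoc_weylDelta_eq` (+ ★ `exists_isSiegelIntDecomp`, ★ `IsGoodPlace`)
import Summits.HodgeConjecture.HodgeConjecture.Theorems.K2LiuKindOneLineGoodPlaceLetters      -- ★ (KW1-g) `exists_cofinite_goodPlaceLetters`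
import Summits.HodgeConjecture.HodgeConjecture.Theorems.K2LiuKindOneLineCharacterReading     -- ★ (KW1-b2′) `conj_unipDeltaChar_coord_eq`, `normAbs_xi_eq_one_of_integral`
import Summits.HodgeConjecture.HodgeConjecture.Theorems.K2LiuTateCharacterLocalTrace         -- ★ B3 Tate's local trace letters `toLocalRing_algebraTrace`, `algebraTrace_toLocalRing_mul`, `prod_adicComponent_adeleAddChar_eq`
import Summits.HodgeConjecture.HodgeConjecture.Theorems.K2LiuKindOneLineFactorizable         -- ★ (KW1-e)(e3) `isFactorizableOff_cornerTranslate` (+ ★ (e3-loc), ★ (e2) `blkD`)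
import Summits.HodgeConjecture.HodgeConjecture.Theorems.K2LiuKindWCarrierOfRecord             -- ★ (KW-car) ED. 2 `exists_kindW_carrierLetters_haar`
import Summits.HodgeConjecture.HodgeConjecture.Theorems.K2LiuLineCornerChartHaar              -- ★ p862728 `isHaarMeasure_map_lineChart`
import HarnessLib

/-!
# Crux `HLiu418`, socket #41, KIND 1 ∕ package (K1b-♮), letter (dec-2-pay) F2α — `K2LiuKindOneLineCornerEuler`: THE RANK-ONE KIND-W EULER IDENTITY AT THE
# CORNER-TRANSLATE FAMILY `y ↦ f_s(blkD(1,y)·g)` — `W⁽ᴮ⁾_{Sℓ}(f_s(blkD(1,·)·g))(h) = I_{U}(Sℓ, s+n₁∕2, h) · (L^{U}(2s+n₁+1, ε_{L∕L⁺}))⁻¹`, `U = U(Sℓ,h)`,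
# with the rank-one good-place letter `hJ` PAID COFINITELY

Cell `hodgecm-mathlib`, crux item hLiu418 = `stmt-HodgeConjecture-24832` (helper lane `--supports … --as helper`, count-neutral), route of record `HCCMUnconditional`;
squad K2 ∕ K2Liu, road `K2_Liu`, socket #41, KIND 1, package (K1b-♮).  The K1-b♮ residue at the tie is the LINE's EXPLICIT CHAIN `hchain₁` of F1 ★ p865057∕p865205∕p865283
`K2LiuKindOneLineBlockLetterOfRecord(KType)(Lam).blockLetter_rate_of_record(_ktype)(_lam)`; LH4-p14 (g9)'s census `CENSUS-F2-hchain1` cuts its payer F2 into F2α (M0–M4: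
the Euler identity at the corner translate), F2β ★ p865320 (the frame reading), F2γ (tensor Fubini + `Ffin_def`) and the assembler.  THIS FILE is F2α:
* §1 **`exists_finset_lineJ`** — THE RANK-ONE GOOD-PLACE LETTER `hJ` OF ★ (KW1-b) `whittakerDelta_eq_kindWPart_mul_line` (:160–167), PAID COFINITELY (the `n = 1` twin of
  ★ (KW-J′) `exists_finset_hJ`): LINE datum `(e : Fin N × Fin M ≃ Fin 1, dV, dW)` (`dV dW ≠ 0`), carriers `νv` with `hνK`, `χ` unramified off `T₀` with the restriction letter
  `hε : χ|_{𝕀_{L⁺}} = ε_{L∕L⁺}` ⟹ `∃ U₁ ⊇ T₀`, for every SKEW NON-ZERO line index `S` (`σ S₀₀ = −S₀₀ ≠ 0`), `h`, `0 < re s`, `v ∉ U(S,h) = kindWPlaces ↑U₁ S h`: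
  `∫ conj ψ_S(ι_v y)·Λ_{s,v}((w_Δ)_v y) dν_v(y) = 1 − ε(ϖ_v) q_v^{−(2s+1)}` — ★ (KW1-b2) at `v`, its by-value letters discharged by ★ (KW1-g) (`hχ h2 hδw hα hvol`), ★
  `eventually_isGoodPlace` at `n = 1` (conductor of `ψ_v := adeleAddCharAt L⁺ v`), ★ B3 (Tate's trace `τ`) and ★ (KW1-b2′) (coordinate reading; the unit `ξ = τ(½·S₀₀·δ)` off `U(S,h)`).
* §2 **`whittakerDelta_cornerTranslate_eq_kindWPart_mul_line`** — HYPOTHESIS-FIRST EULER AT THE CORNER TRANSLATE: see-saw datum `V = A ⊕ B` (`eV eA eB dA dB dV hVA hVB dW`,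
  F1's shapes, generic sizes), the `B`-line carriers `(T₀ νN νv hνK νinf hσ hmap)` + `hχ` in ★ (KW1-b)'s bytes, a big family `f` factorizable off `T ⊆ T₀` through `fT`
  (★ (KW-fac) `exists_kindW_factorization` (2), by value), a translate `g ∈ H_V(𝔸)` hyperspecial off `T₀` (`hg`), Siegel-integral decompositions in `H_B(L⁺_v)` off `T₀` (`hIw`),
  a line index `Sℓ`, `0 < re s`, the integrability `hG` and the letter `hJ` AT PARAMETER `s + n₁∕2` (§1 pays it) ⟹
  `W⁽ᴮ⁾_{Sℓ}(y ↦ f_s(blkD(1,y)·g))(h) = kindWPart⁽ᴮ⁾(T♯, νinf T♯, νv, F♯, Sℓ, s + n₁∕2, h) · (L^{U(Sℓ,h)}(2(s+n₁∕2)+1, ε_{L∕L⁺}))⁻¹`, `T♯ = kindWFinset T₀ Sℓ h`, `F♯` = the EXPLICIT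
  `T♯`-part of ★ (KW1-e)(e3) `isFactorizableOff_cornerTranslate` — ★ (KW1-b) for the REPARAMETRISED family `Φ_{s′}(y) := f_{s′−n₁∕2}(blkD(1,y)·g)` at `s′ = s + n₁∕2`.
  `whittakerDelta_eq_zero_of_not_integrable` — the other branch of the Bochner dichotomy (no (KW1-a) majorant is needed by the payer); `kindWPlaces_mono`.
* §3 **`exists_lineEuler_cornerTranslate`** — THE ∃-PACKAGE AT THE LINE CHART `νN := Measure.map nB μ` (★ `isHaarMeasure_map_lineChart`): carriers by ★ (KW-car)
  `exists_kindW_carrierLetters_haar`, `U₁` by §1, `hg` by ★ `eventually_evalPlace_mem_localInt`, `hIw` by ★ `exists_isSiegelIntDecomp` ∘ ★ `eventually_isGoodPlace`;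
  left by value: `hε` (★ `isSplittingChar_one_toHeckeCharacter_inv` pays it for `μ̃ = toHeckeCharacter L λ⁻¹`) and the big family's factorization `hf`.
[KudlaRallis1994, §1–§2], [Tan1999, §2–§3], [Liu2011, §2A (2-10), §2B p. 862], [HarrisKudlaSweet1996, §6 (6.14)–(6.16)], [Shimura1997, §18.1 (18.4)], [Casselman1980, §3].
HONEST LABEL.  Count-neutral helper, closes no socket by itself: `HC_CM` is proved only modulo the 7 printed citations (2 remaining named inputs: hLiu418 =
`stmt-HodgeConjecture-24832`, h413 = `stmt-HodgeConjecture-24833`) until rung 0 closes.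

## References
* [KudlaRallis1994] S. Kudla, S. Rallis, *A regularized Siegel–Weil formula: the first term identity*, Ann. of Math. 140 (1994): §1–§2 (Euler factorisation of `W_β` off a finite set).
* [Tan1999] V. Tan, *Poles of Siegel Eisenstein series on U(n,n)*, Canad. J. Math. 51 (1999): §2–§3 (`n = 1`).
* [Liu2011] Y. Liu, *Arithmetic theta lifting and L-derivatives for unitary groups, I*, Algebra Number Theory 5 (2011): §2A (2-10) (`b₁(s) = L(2s+1, ε)`), §2B p. 862.
* [HarrisKudlaSweet1996] M. Harris, S. Kudla, W. J. Sweet, J. AMS 9 (1996): §6 (6.14)–(6.16) (the unramified rank-one computation, parity of the local parameter).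
* [Shimura1997] G. Shimura, *Euler Products and Eisenstein Series*, CBMS 93 (1997): §18.1 (18.4), §18.3.
* [Casselman1980] W. Casselman, Compositio Math. 40 (1980): §3 Thm. 3.1.
-/

set_option autoImplicit false
-- the mandated namespace repeats the single-problem summit's segment (`HodgeConjecture.HodgeConjecture`)
set_option linter.dupNamespace false

noncomputable section

open scoped Matrix RestrictedProduct ENNReal NNReal Topology ComplexConjugate
open NumberField IsDedekindDomain MeasureTheory Measure Filter Set
open Literature.NumberTheory.Automorphic Literature.NumberTheory.Automorphic.UnitaryGroup Literature.NumberTheory.GaloisRepresentations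
open Literature.NumberTheory.LFunctions
open Literature.NumberTheory.GelbartRogawski1991 Literature.NumberTheory.GelbartRogawski1991.GRConstruction
open Literature.NumberTheory.GelbartRogawski1991.UnitaryDualPair
open Literature.NumberTheory.K2Lit Literature.NumberTheory.K2Lit.SiegelDoubled Literature.NumberTheory.K2Lit.PlaceSplitting
open Literature.MeasureTheory.RestrictedProduct
open Literature.Topology.Algebra.RestrictedProduct (inH)
open Summit.HodgeConjecture.HodgeConjecture.Cruxes.HLiu418.K2LiuSiegelUnipotentLocalDefs
open Summit.HodgeConjecture.HodgeConjecture.Cruxes.HLiu418.K2LiuSiegelUnipotentSplitDefs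
open Summit.HodgeConjecture.HodgeConjecture.Cruxes.HLiu418.K2LiuSiegelUnipotentSplitAtDefs
open Summit.HodgeConjecture.HodgeConjecture.Cruxes.HLiu418.K2LiuSiegelUnipotentFourierDefs
open Summit.HodgeConjecture.HodgeConjecture.Cruxes.HLiu418.K2LiuSiegelEisensteinKindWLetters
open Summit.HodgeConjecture.HodgeConjecture.Cruxes.HLiu418.K2LiuKindOneLineWhittakerEuler (whittakerDelta_eq_kindWPart_mul_line)
open Summit.HodgeConjecture.HodgeConjecture.Cruxes.HLiu418.K2LiuKindOneLineGoodPlaceFactor (integral_conj_unipDeltaChar_mul_lambdaLoc_weylDelta_eq)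
open Summit.HodgeConjecture.HodgeConjecture.Cruxes.HLiu418.K2LiuKindOneLineGoodPlaceLetters (exists_cofinite_goodPlaceLetters)
open Summit.HodgeConjecture.HodgeConjecture.Cruxes.HLiu418.K2LiuKindOneLineCharacterReading (conj_unipDeltaChar_coord_eq normAbs_xi_eq_one_of_integral)
open Summit.HodgeConjecture.HodgeConjecture.Cruxes.HLiu418.K2LiuTateCharacterLocalTrace
open Summit.HodgeConjecture.HodgeConjecture.Cruxes.HLiu418.K2LiuSphericalSectionLambdaLoc (exists_isSiegelIntDecomp)
open Summit.HodgeConjecture.HodgeConjecture.Cruxes.HLiu418.K2LiuKindOneLineFactorizable (isFactorizableOff_cornerTranslate)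
open Summit.HodgeConjecture.HodgeConjecture.Cruxes.HLiu418.K2LiuKindWCarrierOfRecord (exists_kindW_carrierLetters_haar)
open Summit.HodgeConjecture.HodgeConjecture.Cruxes.HLiu418.K2LiuLineCornerChartHaar (isHaarMeasure_map_lineChart)

namespace Summit.HodgeConjecture.HodgeConjecture.Cruxes.HLiu418.K2LiuKindOneLineCornerEuler

variable (L : Type) [Field L] [NumberField L] [IsCMField L]

/-! ## §1 The rank-one good-place letter `hJ` of ★ (KW1-b), paid cofinitely -/

section LineJ
variable {N M : ℕ} (e : Fin N × Fin M ≃ Fin 1)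
  (dV : Fin N → L) (hdV : ∀ i, IsCMField.complexConj L (dV i) = dV i) (hdV0 : ∀ i, dV i ≠ 0)
  (dW : Fin M → L) (hdW : ∀ i, IsCMField.complexConj L (dW i) = dW i) (hdW0 : ∀ i, dW i ≠ 0)
  [∀ v : HeightOneSpectrum (𝓞 (Fp L)), MeasurableSpace ↥(unipDeltaLoc L e dV hdV dW hdW v)]
  [∀ v : HeightOneSpectrum (𝓞 (Fp L)), BorelSpace ↥(unipDeltaLoc L e dV hdV dW hdW v)]

include hdV0 hdW0 in
/-- **THE RANK-ONE GOOD-PLACE LETTER `hJ` OF ★ (KW1-b), PAID COFINITELY** (the `n = 1` twin of ★ (KW-J′) `exists_finset_hJ`).  Doubled LINE datum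
`(e : Fin N × Fin M ≃ Fin 1, dV, dW)` of the K2Lit CM frame with `dV, dW ≠ 0`; local carriers `νv` normalised by ★ (KW1-b)'s `hνK`; a Hecke character `χ` of `L` unramified
above every `v ∉ T₀` (`hχ`) with the restriction letter `hε : χ|_{𝕀_{L⁺}} = ε_{L∕L⁺} = quadraticHeckeCharCM L`.  THEN there is a finite `U₁ ⊇ T₀` such that ★ (KW1-b)'s binder
`hJ` (:160–167) holds VERBATIM at `T₀ := U₁` for every SKEW NON-ZERO line index `S` (`σ S₀₀ = −S₀₀`, `S₀₀ ≠ 0`), every `h`, every `s` with `0 < re s`: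
`∀ v ∉ kindWPlaces ↑U₁ S h, ∫ conj ψ_S(ι_v y)·Λ_{s,v}((w_Δ)_v y) dν_v(y) = 1 − ε(ϖ_v)·q_v^{−(2s+1)}`.  PROOF: ★ (KW1-b2) at `v`, fed by ★ (KW1-g) (`hχ h2 hδw hα hvol` off `U₁′ ⊇ T₀`),
★ `eventually_isGoodPlace` at `n = 1` (conductor `𝒪_v` of `ψ_v = adeleAddCharAt L⁺ v`), Tate's local trace (★ B3) and ★ (KW1-b2′) (coordinate reading; the unit
`ξ = Tr(½·S₀₀·δ)` from the off-`U(S,h)` integrality of `S`, `S⁻¹`).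
[cite: HarrisKudlaSweet1996, §6 (6.14)–(6.16)] [cite: Liu2011, §2A (2-10)] [cite: Shimura1997, §18.1 (18.4)] [cite: Casselman1980, §3 Thm. 3.1] -/
theorem exists_finset_lineJ (T₀ : Finset (HeightOneSpectrum (𝓞 (Fp L))))
    (νv : ∀ v : HeightOneSpectrum (𝓞 (Fp L)), Measure ↥(unipDeltaLoc L e dV hdV dW hdW v)) [∀ v, (νv v).IsHaarMeasure]
    (hνK : ∀ v, νv v (((inH (fun v => UnitaryGroup.localInt L (IsCMField.complexConj L) (1 + 1) (hermD L e dV hdV dW hdW) v)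
      (fun v => unipDeltaLoc L e dV hdV dW hdW v) v) : Subgroup ↥(unipDeltaLoc L e dV hdV dW hdW v)) : Set ↥(unipDeltaLoc L e dV hdV dW hdW v)) = 1)
    {χ : HeckeCharacter L} (hχ : ∀ v, v ∉ T₀ → ∀ w' : UnitaryGroup.PlacesOver L v, χ.IsUnramifiedAt w'.1)
    (hε : ∀ a : ideleGroup (Fp L), χ (AdeleRing.ideleBaseChange (Fp L) L a) = quadraticHeckeCharCM L a) :
    ∃ U₁ : Finset (HeightOneSpectrum (𝓞 (Fp L))), T₀ ⊆ U₁ ∧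
      ∀ (S : Matrix (Fin 1) (Fin 1) L), IsCMField.complexConj L (S 0 0) = -S 0 0 → S 0 0 ≠ 0 →
      ∀ (h : HA L e dV hdV dW hdW) (s : ℂ), 0 < s.re →
      ∀ v, v ∉ kindWPlaces L e dV hdV dW hdW (U₁ : Set (HeightOneSpectrum (𝓞 (Fp L)))) S h →
        ∫ y, conj (unipDeltaChar L e dV hdV dW hdW S
              (locToAdelic L e dV hdV dW hdW v (y : UnitaryGroup.localPi L (IsCMField.complexConj L) (1 + 1) (hermD L e dV hdV dW hdW) v)) : ℂ) *
            LambdaLoc L e dV hdV dW hdW v χ s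
              (UnitaryGroup.evalPlace (Fp L) L (IsCMField.complexConj L) (1 + 1) (hermD L e dV hdV dW hdW) v
                  (UnitaryGroup.finPart (Fp L) L (IsCMField.complexConj L) (1 + 1) (hermD L e dV hdV dW hdW) (weylDelta L e dV hdV dW hdW)) *
                (y : UnitaryGroup.localPi L (IsCMField.complexConj L) (1 + 1) (hermD L e dV hdV dW hdW) v)) ∂(νv v) =
          1 - (quadraticHeckeCharCM L).valueAtUniformizer v * (v.residueCard : ℂ) ^ (-(2 * s + 1)) := by
  classical
  haveI : Algebra.IsQuadraticExtension (Fp L) L := IsCMField.isQuadraticExtension L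
  -- ★ (KW1-g): the five by-value letters of ★ (KW1-b2), off `U₁′ ⊇ T₀`
  obtain ⟨U₁', hT₀U, hkit⟩ := exists_cofinite_goodPlaceLetters L e dV hdV dW hdW T₀ hχ hε νv hνK
  -- ★ `eventually_isGoodPlace` at `n = 1`: the conductor of `ψ_v` (and the Gram letters), cofinitely
  have hχ' : ∀ᶠ v : HeightOneSpectrum (𝓞 (Fp L)) in cofinite, ∀ w' : UnitaryGroup.PlacesOver L v, χ.IsUnramifiedAt w'.1 :=
    T₀.eventually_cofinite_notMem.mono fun v hv => hχ v hv
  have hgood := LocalSplitting.eventually_isGoodPlace (Fp L) L (imagUnit L) 1 (gramR L e dV hdV dW hdW) (imagUnit_ne_zero L)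
    (isUnit_det_gramR₀ L e dV hdV hdV0 dW hdW hdW0) (fun v (w : UnitaryGroup.PlacesOver L v) => χ.localComponent w.1)
    (hχ'.mono fun v hv w u hu => (hv w).localComponent_eq_one_of_valuation_eq_one hu)
  set B : Finset (HeightOneSpectrum (𝓞 (Fp L))) := (Filter.eventually_cofinite.1 hgood).toFinset with hB
  have hBspec : ∀ v, v ∉ B → LocalSplitting.IsGoodPlace (Fp L) L (imagUnit L) v 1 (gramR L e dV hdV dW hdW) (fun w => χ.localComponent w.1) := by
    intro v hv
    by_contra h
    exact hv ((Set.Finite.mem_toFinset _).2 h)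
  refine ⟨U₁' ∪ B, hT₀U.trans Finset.subset_union_left, ?_⟩
  intro S hSσ hS0 h s hs v hv
  have hvU : v ∉ U₁' ∧ v ∉ B := by
    have h' : v ∉ U₁' ∪ B := fun h' => not_mem_of_not_mem_kindWPlaces L e dV hdV dW hdW hv (Finset.mem_coe.2 h')
    rwa [Finset.mem_union, not_or] at h'
  obtain ⟨hχv, h2, hδw, hα, hvol⟩ := hkit v hvU.1
  have hg := hBspec v hvU.2
  -- the additive Borel structure of `L⁺_v` (★ (KW1-b2)'s frame instance)
  letI : MeasurableSpace (v.adicCompletion (Fp L)) := borel _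
  haveI : BorelSpace (v.adicCompletion (Fp L)) := ⟨rfl⟩
  -- the unit `ξ = Tr(½·S₀₀·δ)` (★ (KW1-b2′)) from the off-`U(S,h)` integrality of `S` and `S⁻¹`
  have hξ := normAbs_xi_eq_one_of_integral L v
    (toLocalRing_algebraTrace L v (IsCMField.complexConj L) (complexConj_imagUnit L) (imagUnit_ne_zero L)) S hSσ hS0
    (fun w i j => integral_of_not_mem_kindWPlaces L e dV hdV dW hdW hv w i j)
    (fun w i j => inv_integral_of_not_mem_kindWPlaces L e dV hdV dW hdW hv w i j) hδw
  -- ★ (KW1-b2) at `v`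
  exact integral_conj_unipDeltaChar_mul_lambdaLoc_weylDelta_eq L e dV hdV hdV0 dW hdW hdW0 v (νv v) hvol hχv hs h2 hδw
    (HeckeCharacter.valued_uniformizer (K := Fp L) v) (fun w => (map_ne_zero (toPlace v w)).2 (HeckeCharacter.uniformizer (Fp L) v).ne_zero)
    (hα (HeckeCharacter.valued_uniformizer (K := Fp L) v) _) (continuous_adeleAddCharAt (Fp L) v) hg.psi hξ S
    (conj_unipDeltaChar_coord_eq L e dV hdV hdV0 dW hdW hdW0 v (algebraTrace_toLocalRing_mul L v) (prod_adicComponent_adeleAddChar_eq L v) S)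

end LineJ

/-! ## §2 The Euler identity at the corner-translate family (hypothesis-first) -/

section CornerEuler

-- `Classical` decidability on the places of `L⁺`, as in ★ (KW1-e)(e3) `isFactorizableOff_cornerTranslate` (whose `T'`-part — `∏_{v ∈ T'∖T}`, `if v ∈ T'` — enters the
-- statements below verbatim) and in the consumers F1 ★ p865057 ∕ F2β ★ p865320
open scoped Classical

variable {N₁ N₂ M n n₁ n₂ : ℕ} (eV : Fin (N₁ + N₂) × Fin M ≃ Fin n) (eA : Fin N₁ × Fin M ≃ Fin n₁) (eB : Fin N₂ × Fin M ≃ Fin n₂)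
  (dA : Fin N₁ → L) (hdA : ∀ i, IsCMField.complexConj L (dA i) = dA i)
  (dB : Fin N₂ → L) (hdB : ∀ i, IsCMField.complexConj L (dB i) = dB i)
  (dV : Fin (N₁ + N₂) → L) (hdV : ∀ i, IsCMField.complexConj L (dV i) = dV i)
  (hVA : ∀ i, dV (Fin.castAdd N₂ i) = dA i) (hVB : ∀ j, dV (Fin.natAdd N₁ j) = dB j)
  (dW : Fin M → L) (hdW : ∀ i, IsCMField.complexConj L (dW i) = dW i)

/-- **the junk branch of the Bochner dichotomy**: off integrability of the global Whittaker integrand the big-cell coefficient `W_S(φ)(h)` is `0` (`whittakerDelta` is a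
literal Bochner integral) — so a bound of `‖W‖` by a non-negative quantity needs NO majorant on the non-integrable locus. [cite: KudlaRallis1994, §2] -/
theorem whittakerDelta_eq_zero_of_not_integrable [MeasurableSpace ↥(unipDelta L eB dB hdB dW hdW)] (νN : Measure ↥(unipDelta L eB dB hdB dW hdW))
    (S : Matrix (Fin n₂) (Fin n₂) L) (φ : HA L eB dB hdB dW hdW → ℂ) (h : HA L eB dB hdB dW hdW)
    (hG : ¬ Integrable (fun u : ↥(unipDelta L eB dB hdB dW hdW) =>
      conj (unipDeltaChar L eB dB hdB dW hdW S (u : HA L eB dB hdB dW hdW) : ℂ) * φ (weylDelta L eB dB hdB dW hdW * (u : HA L eB dB hdB dW hdW) * h)) νN) :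
    whittakerDelta L eB dB hdB dW hdW νN S φ h = 0 :=
  integral_undef hG

/-- `U(S,h)` is monotone in the bad set: `T₀ ⊆ T₀′ ⇒ kindWPlaces T₀ S h ⊆ kindWPlaces T₀′ S h`. [folklore] -/
theorem kindWPlaces_mono {T₀ T₀' : Set (HeightOneSpectrum (𝓞 (Fp L)))} (hT : T₀ ⊆ T₀') (S : Matrix (Fin n₂) (Fin n₂) L) (h : HA L eB dB hdB dW hdW) :
    kindWPlaces L eB dB hdB dW hdW T₀ S h ⊆ kindWPlaces L eB dB hdB dW hdW T₀' S h := by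
  rintro v ((((hv | hv) | hv) | hv) | hv)
  exacts [Or.inl (Or.inl (Or.inl (Or.inl (hT hv)))), Or.inl (Or.inl (Or.inl (Or.inr hv))), Or.inl (Or.inl (Or.inr hv)), Or.inl (Or.inr hv), Or.inr hv]

variable [MeasurableSpace ↥(unipDelta L eB dB hdB dW hdW)] [BorelSpace ↥(unipDelta L eB dB hdB dW hdW)]
  [MeasurableSpace ↥(unipDeltaArch L eB dB hdB dW hdW)] [BorelSpace ↥(unipDeltaArch L eB dB hdB dW hdW)]
  [∀ v : HeightOneSpectrum (𝓞 (Fp L)), MeasurableSpace ↥(unipDeltaLoc L eB dB hdB dW hdW v)]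
  [∀ v : HeightOneSpectrum (𝓞 (Fp L)), BorelSpace ↥(unipDeltaLoc L eB dB hdB dW hdW v)]

set_option maxHeartbeats 800000 in -- MEASURED: 200 000 ✗ (`isDefEq` in the statement) ∕ 400 000 ✗ (`whnf`) ∕ 800 000 ✓ — ★ (KW1-b)'s binder telescope with ★ (KW1-e)(e3)'s two-datum `T'`-part inside; plain `rw`∕`simp only`∕`exact`, no search tactics
/-- **THE RANK-ONE KIND-W EULER IDENTITY AT THE CORNER-TRANSLATE FAMILY** (hypothesis-first; (M2)–(M4) of LH4-p14 (g9)'s census).  See-saw datum `V = A ⊕ B`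
(`eV eA eB dA dB dV hVA hVB dW`, F1's shapes, generic sizes); on the `B`-line: the carriers `T₀ νN νv hνK νinf hσ hmap` and `hχ` in ★ (KW1-b)'s BYTES; a big family `f` on
`H_V(𝔸)` factorizable off `T ⊆ T₀` through `fT` (★ (KW-fac) `exists_kindW_factorization` (2)); a translate `g ∈ H_V(𝔸)` hyperspecial off `T₀` (`hg`); Siegel-integral
decompositions in `H_B(L⁺_v)` off `T₀` (`hIw`, ★ `exists_isSiegelIntDecomp`); a line index `Sℓ`, `0 < re s`, a point `h ∈ H_B(𝔸)`; the integrability `hG` of the line's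
global Whittaker integrand of `y ↦ f_s(blkD(1,y)·g)`; and ★ (KW1-b)'s rank-one letter `hJ` on the `B`-line AT PARAMETER `s + n₁∕2` (§1 `exists_finset_lineJ` pays it at
`T₀ := U₁`).  THEN **`W⁽ᴮ⁾_{Sℓ}(y ↦ f_s(blkD(1,y)·g))(h) = kindWPart⁽ᴮ⁾(T♯, νinf T♯, νv, F♯, Sℓ, s + n₁∕2, h) · (L^{U(Sℓ,h)}(2(s + n₁∕2) + 1, ε_{L∕L⁺}))⁻¹`**,
`T♯ = kindWFinset T₀ Sℓ h`, `U(Sℓ,h) = kindWPlaces ↑T₀ Sℓ h`, where `F♯` is the EXPLICIT `T♯`-part of ★ (KW1-e)(e3) `isFactorizableOff_cornerTranslate`: the big `fT` read at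
`((blkD(1,(a,1))·g)_∞, (B_v(y_v)·g_v)_{v∈T})` at parameter `s′ − n₁∕2`, times `∏_{v∈T♯∖T} Λ^{(V)}_{s′−n₁∕2,v}(B_v(y_v)·g_v)`.  PROOF: ★ (KW1-b) `whittakerDelta_eq_kindWPart_mul_line`
on the `B`-line for the REPARAMETRISED family `Φ_{s′}(y) := f_{s′−n₁∕2}(blkD(1,y)·g)` (factorizable off every `T′ ⊇ T₀` by ★ (e3)) at `s′ := s + n₁∕2`.
[cite: KudlaRallis1994, §1–§2] [cite: Tan1999, §2–§3] [cite: Liu2011, §2A (2-10), §2B p. 862] -/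
theorem whittakerDelta_cornerTranslate_eq_kindWPart_mul_line (T₀ : Finset (HeightOneSpectrum (𝓞 (Fp L))))
    (νN : Measure ↥(unipDelta L eB dB hdB dW hdW))
    (νv : ∀ v : HeightOneSpectrum (𝓞 (Fp L)), Measure ↥(unipDeltaLoc L eB dB hdB dW hdW v)) [∀ v, (νv v).IsHaarMeasure] [∀ v, SigmaFinite (νv v)]
    (hνK : ∀ v, νv v (((inH (fun v => UnitaryGroup.localInt L (IsCMField.complexConj L) (n₂ + n₂) (hermD L eB dB hdB dW hdW) v)
      (fun v => unipDeltaLoc L eB dB hdB dW hdW v) v) : Subgroup ↥(unipDeltaLoc L eB dB hdB dW hdW v)) : Set ↥(unipDeltaLoc L eB dB hdB dW hdW v)) = 1)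
    (νinf : Finset (HeightOneSpectrum (𝓞 (Fp L))) → Measure ↥(unipDeltaArch L eB dB hdB dW hdW)) (hσ : ∀ T, SigmaFinite (νinf T))
    (hmap : ∀ T : Finset (HeightOneSpectrum (𝓞 (Fp L))), Measure.map (unipDeltaSplitAt L eB dB hdB dW hdW T) νN =
      (νinf T).prod ((Measure.pi fun v : T => νv v.1).prod
        (rpMeasure (fun v : {v : HeightOneSpectrum (𝓞 (Fp L)) // v ∉ T} => ((inH (fun v => UnitaryGroup.localInt L (IsCMField.complexConj L) (n₂ + n₂) (hermD L eB dB hdB dW hdW) v)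
          (fun v => unipDeltaLoc L eB dB hdB dW hdW v) v.1 : Subgroup ↥(unipDeltaLoc L eB dB hdB dW hdW v.1)) : Set ↥(unipDeltaLoc L eB dB hdB dW hdW v.1))) (fun v => νv v.1) ∅)))
    {χ : HeckeCharacter L} (hχ : ∀ v, v ∉ T₀ → ∀ w' : UnitaryGroup.PlacesOver L v, χ.IsUnramifiedAt w'.1)
    {T : Finset (HeightOneSpectrum (𝓞 (Fp L)))} (hT : T ⊆ T₀)
    {f : ℂ → HA L eV dV hdV dW hdW → ℂ}
    {fT : ℂ → UnitaryGroup.arch (Fp L) L (IsCMField.complexConj L) (n + n) (hermD L eV dV hdV dW hdW) ×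
      (Π v : ↥T, UnitaryGroup.localPi L (IsCMField.complexConj L) (n + n) (hermD L eV dV hdV dW hdW) v.1) → ℂ}
    (hf : IsFactorizableOff L eV dV hdV dW hdW T χ f fT) {g : HA L eV dV hdV dW hdW}
    (hg : ∀ v, v ∉ T₀ → UnitaryGroup.evalPlace (Fp L) L (IsCMField.complexConj L) (n + n) (hermD L eV dV hdV dW hdW) v
      (UnitaryGroup.finPart (Fp L) L (IsCMField.complexConj L) (n + n) (hermD L eV dV hdV dW hdW) g) ∈ UnitaryGroup.localInt L (IsCMField.complexConj L) (n + n) (hermD L eV dV hdV dW hdW) v)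
    (hIw : ∀ v, v ∉ T₀ → ∀ u : UnitaryGroup.localPi L (IsCMField.complexConj L) (n₂ + n₂) (hermD L eB dB hdB dW hdW) v, ∃ pk, IsSiegelIntDecomp L eB dB hdB dW hdW v u pk)
    (Sℓ : Matrix (Fin n₂) (Fin n₂) L) {s : ℂ} (hs : 0 < s.re) (h : HA L eB dB hdB dW hdW)
    (hG : Integrable (fun u : ↥(unipDelta L eB dB hdB dW hdW) =>
      conj (unipDeltaChar L eB dB hdB dW hdW Sℓ (u : HA L eB dB hdB dW hdW) : ℂ) *
        f s (blkD L eV eA eB dA hdA dB hdB dV hdV hVA hVB dW hdW (1, weylDelta L eB dB hdB dW hdW * (u : HA L eB dB hdB dW hdW) * h) * g)) νN)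
    (hJ : ∀ v, v ∉ kindWPlaces L eB dB hdB dW hdW (T₀ : Set (HeightOneSpectrum (𝓞 (Fp L)))) Sℓ h →
      ∫ y, conj (unipDeltaChar L eB dB hdB dW hdW Sℓ
            (locToAdelic L eB dB hdB dW hdW v (y : UnitaryGroup.localPi L (IsCMField.complexConj L) (n₂ + n₂) (hermD L eB dB hdB dW hdW) v)) : ℂ) *
          LambdaLoc L eB dB hdB dW hdW v χ (s + (n₁ : ℂ) / 2)
            (UnitaryGroup.evalPlace (Fp L) L (IsCMField.complexConj L) (n₂ + n₂) (hermD L eB dB hdB dW hdW) v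
                (UnitaryGroup.finPart (Fp L) L (IsCMField.complexConj L) (n₂ + n₂) (hermD L eB dB hdB dW hdW) (weylDelta L eB dB hdB dW hdW)) *
              (y : UnitaryGroup.localPi L (IsCMField.complexConj L) (n₂ + n₂) (hermD L eB dB hdB dW hdW) v)) ∂(νv v) =
        1 - (quadraticHeckeCharCM L).valueAtUniformizer v * (v.residueCard : ℂ) ^ (-(2 * (s + (n₁ : ℂ) / 2) + 1))) :
    whittakerDelta L eB dB hdB dW hdW νN Sℓ (fun y => f s (blkD L eV eA eB dA hdA dB hdB dV hdV hVA hVB dW hdW (1, y) * g)) h =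
      kindWPart L eB dB hdB dW hdW (kindWFinset L eB dB hdB dW hdW T₀ Sℓ h) (νinf (kindWFinset L eB dB hdB dW hdW T₀ Sℓ h)) νv
          (fun s' q =>
            fT (s' - (n₁ : ℂ) / 2) (UnitaryGroup.archPart (Fp L) L (IsCMField.complexConj L) (n + n) (hermD L eV dV hdV dW hdW) (blkD L eV eA eB dA hdA dB hdB dV hdV hVA hVB dW hdW (1, (UnitaryGroup.archToAdelic (Fp L) L (IsCMField.complexConj L) (n₂ + n₂) (hermD L eB dB hdB dW hdW) q.1 : HA L eB dB hdB dW hdW)) * g),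
                fun v : ↥T => UnitaryGroup.evalPlace (Fp L) L (IsCMField.complexConj L) (n + n) (hermD L eV dV hdV dW hdW) v.1 (UnitaryGroup.finPart (Fp L) L (IsCMField.complexConj L) (n + n) (hermD L eV dV hdV dW hdW) (blkD L eV eA eB dA hdA dB hdB dV hdV hVA hVB dW hdW (1, locToAdelic L eB dB hdB dW hdW v.1 (q.2 ⟨v.1, (hT.trans (subset_kindWFinset L eB dB hdB dW hdW T₀ Sℓ h)) v.2⟩)))) *
                  UnitaryGroup.evalPlace (Fp L) L (IsCMField.complexConj L) (n + n) (hermD L eV dV hdV dW hdW) v.1 (UnitaryGroup.finPart (Fp L) L (IsCMField.complexConj L) (n + n) (hermD L eV dV hdV dW hdW) g)) *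
              ∏ v ∈ kindWFinset L eB dB hdB dW hdW T₀ Sℓ h \ T, LambdaLoc L eV dV hdV dW hdW v χ (s' - (n₁ : ℂ) / 2)
                (if hv : v ∈ kindWFinset L eB dB hdB dW hdW T₀ Sℓ h then UnitaryGroup.evalPlace (Fp L) L (IsCMField.complexConj L) (n + n) (hermD L eV dV hdV dW hdW) v (UnitaryGroup.finPart (Fp L) L (IsCMField.complexConj L) (n + n) (hermD L eV dV hdV dW hdW) (blkD L eV eA eB dA hdA dB hdB dV hdV hVA hVB dW hdW (1, locToAdelic L eB dB hdB dW hdW v (q.2 ⟨v, hv⟩)))) * UnitaryGroup.evalPlace (Fp L) L (IsCMField.complexConj L) (n + n) (hermD L eV dV hdV dW hdW) v (UnitaryGroup.finPart (Fp L) L (IsCMField.complexConj L) (n + n) (hermD L eV dV hdV dW hdW) g) else 1))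
          Sℓ (s + (n₁ : ℂ) / 2) h *
        (partialStandardL (kindWPlaces L eB dB hdB dW hdW (T₀ : Set (HeightOneSpectrum (𝓞 (Fp L)))) Sℓ h)
            (fun v => {(quadraticHeckeCharCM L).valueAtUniformizer v}) (2 * (s + (n₁ : ℂ) / 2) + 1))⁻¹ := by
  -- the reparametrised corner-translate family is factorizable off every `T' ⊇ T₀` (★ (KW1-e)(e3)), through the `T'`-part guarded by `T ⊆ T'`
  have hfac : ∀ T' : Finset (HeightOneSpectrum (𝓞 (Fp L))), T₀ ⊆ T' →
      IsFactorizableOff L eB dB hdB dW hdW T' χ (fun s' y => f (s' - (n₁ : ℂ) / 2) (blkD L eV eA eB dA hdA dB hdB dV hdV hVA hVB dW hdW (1, y) * g))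
        (if hTT' : T ⊆ T' then fun s' q =>
            fT (s' - (n₁ : ℂ) / 2) (UnitaryGroup.archPart (Fp L) L (IsCMField.complexConj L) (n + n) (hermD L eV dV hdV dW hdW) (blkD L eV eA eB dA hdA dB hdB dV hdV hVA hVB dW hdW (1, (UnitaryGroup.archToAdelic (Fp L) L (IsCMField.complexConj L) (n₂ + n₂) (hermD L eB dB hdB dW hdW) q.1 : HA L eB dB hdB dW hdW)) * g),
                fun v : ↥T => UnitaryGroup.evalPlace (Fp L) L (IsCMField.complexConj L) (n + n) (hermD L eV dV hdV dW hdW) v.1 (UnitaryGroup.finPart (Fp L) L (IsCMField.complexConj L) (n + n) (hermD L eV dV hdV dW hdW) (blkD L eV eA eB dA hdA dB hdB dV hdV hVA hVB dW hdW (1, locToAdelic L eB dB hdB dW hdW v.1 (q.2 ⟨v.1, hTT' v.2⟩)))) *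
                  UnitaryGroup.evalPlace (Fp L) L (IsCMField.complexConj L) (n + n) (hermD L eV dV hdV dW hdW) v.1 (UnitaryGroup.finPart (Fp L) L (IsCMField.complexConj L) (n + n) (hermD L eV dV hdV dW hdW) g)) *
              ∏ v ∈ T' \ T, LambdaLoc L eV dV hdV dW hdW v χ (s' - (n₁ : ℂ) / 2)
                (if hv : v ∈ T' then UnitaryGroup.evalPlace (Fp L) L (IsCMField.complexConj L) (n + n) (hermD L eV dV hdV dW hdW) v (UnitaryGroup.finPart (Fp L) L (IsCMField.complexConj L) (n + n) (hermD L eV dV hdV dW hdW) (blkD L eV eA eB dA hdA dB hdB dV hdV hVA hVB dW hdW (1, locToAdelic L eB dB hdB dW hdW v (q.2 ⟨v, hv⟩)))) * UnitaryGroup.evalPlace (Fp L) L (IsCMField.complexConj L) (n + n) (hermD L eV dV hdV dW hdW) v (UnitaryGroup.finPart (Fp L) L (IsCMField.complexConj L) (n + n) (hermD L eV dV hdV dW hdW) g) else 1)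
          else 0) := by
    intro T' hT'
    rw [dif_pos (hT.trans hT')]
    exact isFactorizableOff_cornerTranslate L eV eA eB dA hdA dB hdB dV hdV hVA hVB dW hdW (hT.trans hT') (HeckeCharacter.isUnramifiedAt_cofinite_holds χ)
      (fun v hv => hχ v fun hv' => hv (hT' hv')) hf (g := g) (fun v hv => hg v fun hv' => hv (hT' hv')) (fun v hv => hIw v fun hv' => hv (hT' hv'))
  have hs' : 0 < (s + (n₁ : ℂ) / 2).re := by
    have h2 : ((n₁ : ℂ) / 2).re = (n₁ : ℝ) / 2 := by simp
    rw [Complex.add_re, h2]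
    positivity
  have hG' : Integrable (fun u : ↥(unipDelta L eB dB hdB dW hdW) =>
      conj (unipDeltaChar L eB dB hdB dW hdW Sℓ (u : HA L eB dB hdB dW hdW) : ℂ) *
        (fun s' y => f (s' - (n₁ : ℂ) / 2) (blkD L eV eA eB dA hdA dB hdB dV hdV hVA hVB dW hdW (1, y) * g)) (s + (n₁ : ℂ) / 2)
          (weylDelta L eB dB hdB dW hdW * (u : HA L eB dB hdB dW hdW) * h)) νN := by
    simpa only [add_sub_cancel_right] using hG
  have hW := whittakerDelta_eq_kindWPart_mul_line L eB dB hdB dW hdW T₀ νN νv hνK νinf hσ hmap hχ hfac Sℓ hs' h hG' hJ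
  simpa only [add_sub_cancel_right, dif_pos (hT.trans (subset_kindWFinset L eB dB hdB dW hdW T₀ Sℓ h))] using hW

end CornerEuler

/-! ## §3 The ∃-package at the line chart `νN := Measure.map nB μ` -/

section Package
open scoped Classical
variable {N₁ n n₁ n₂ : ℕ} (eV : Fin (N₁ + 1) × Fin 1 ≃ Fin n) (eA : Fin N₁ × Fin 1 ≃ Fin n₁) (eB : Fin 1 × Fin 1 ≃ Fin n₂)
  (dA : Fin N₁ → L) (hdA : ∀ i, IsCMField.complexConj L (dA i) = dA i)
  (dB : Fin 1 → L) (hdB : ∀ i, IsCMField.complexConj L (dB i) = dB i) (hdB0 : ∀ i, dB i ≠ 0)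
  (dV : Fin (N₁ + 1) → L) (hdV : ∀ i, IsCMField.complexConj L (dV i) = dV i)
  (hVA : ∀ i, dV (Fin.castAdd 1 i) = dA i) (hVB : ∀ j, dV (Fin.natAdd N₁ j) = dB j)
  (dW : Fin 1 → L) (hdW : ∀ i, IsCMField.complexConj L (dW i) = dW i) (hdW0 : ∀ i, dW i ≠ 0)
  [MeasurableSpace ↥(unipDelta L eB dB hdB dW hdW)] [BorelSpace ↥(unipDelta L eB dB hdB dW hdW)]
  [MeasurableSpace ↥(unipDeltaArch L eB dB hdB dW hdW)] [BorelSpace ↥(unipDeltaArch L eB dB hdB dW hdW)]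
  [∀ v : HeightOneSpectrum (𝓞 (Fp L)), MeasurableSpace ↥(unipDeltaLoc L eB dB hdB dW hdW v)]
  [∀ v : HeightOneSpectrum (𝓞 (Fp L)), BorelSpace ↥(unipDeltaLoc L eB dB hdB dW hdW v)]
  [MeasurableSpace (AdeleRing (𝓞 (Fp L)) (Fp L))] [BorelSpace (AdeleRing (𝓞 (Fp L)) (Fp L))]

include hdB0 hdW0 in
set_option maxHeartbeats 1600000 in -- MEASURED: 800 000 ✗ (`whnf`, declaration) ∕ 1 600 000 ✓ — §2's telescope under six `∃`-binders (★ (KW1-e)(e3)'s budget); plain `rw`∕`simp only`∕`exact`, no search tactics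
/-- **THE ∃-PACKAGE OF THE LINE'S EULER IDENTITY AT THE LINE CHART** ((M0)-free, (M1)–(M4) of LH4-p14 (g9)'s census with every cofinite letter discharged).  See-saw datum
`V = A ⊕ B` with a RANK-ONE `B`-line (`eB : Fin 1 × Fin 1 ≃ Fin n₂`, `dB dW ≠ 0`); an additive Haar measure `μ` on `𝔸_{L⁺}` and the line chart `nB` with its letters
`hnBc hnBadd hnB` (★ p862662 `exists_lineChart`; then `Measure.map nB μ` is a Haar measure on `N_Δ^{(B)}(𝔸)`, ★ `isHaarMeasure_map_lineChart`); a Hecke character `χ` with the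
restriction letter `hε : χ|_{𝕀_{L⁺}} = ε_{L∕L⁺}` (★ `isSplittingChar_one_toHeckeCharacter_inv` for `μ̃ = toHeckeCharacter L λ⁻¹`); a big family `f` factorizable off `T` through
`fT`; a translate `g`.  THEN there are `U₁ ⊇ T`, local carriers `νv` (Haar, σ-finite, `hνK`) and archimedean carriers `νinf T′` (Haar, σ-finite) with the factorisation `hmap`
of `Measure.map nB μ` at every `T′` (★ (KW-car) ED. 2), `χ` unramified above every `v ∉ U₁`, such that for every line index `Sℓ` with skew non-zero diagonal, every `h`,
every `s` with `0 < re s`: EITHER the line's global Whittaker integrand of `y ↦ f_s(blkD(1,y)·g)` is not integrable and `W⁽ᴮ⁾_{Sℓ}(·)(h) = 0`, OR it is and §2's identity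
holds at `T₀ := U₁` — `hJ` by §1, `hg` by ★ `eventually_evalPlace_mem_localInt`, `hIw` by ★ `exists_isSiegelIntDecomp` at the good places of the line (★ `eventually_isGoodPlace`,
`n = 1`: `|2|_w = 1`, `gramR^{(B)}` a `w`-unit). [cite: KudlaRallis1994, §1–§2] [cite: Tan1999, §2–§3] [cite: Liu2011, §2A (2-10), §2B p. 862] [cite: HarrisKudlaSweet1996, §6 (6.16)] -/
theorem exists_lineEuler_cornerTranslate
    (μ : Measure (AdeleRing (𝓞 (Fp L)) (Fp L))) [μ.IsAddHaarMeasure]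
    (nB : AdeleRing (𝓞 (Fp L)) (Fp L) → ↥(unipDelta L eB dB hdB dW hdW)) (hnBc : Continuous nB) (hnBadd : ∀ s t, nB (s + t) = nB s * nB t)
    (hnB : ∀ t, (blk L eB dB hdB dW hdW (nB t : HA L eB dB hdB dW hdW)).toBlocks₁₂ =
      Matrix.of fun _ _ => AdeleRing.baseChange (Fp L) L t * algebraMap L (AdeleRing (𝓞 L) L) (imagUnit L))
    {χ : HeckeCharacter L} (hε : ∀ a : ideleGroup (Fp L), χ (AdeleRing.ideleBaseChange (Fp L) L a) = quadraticHeckeCharCM L a)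
    {T : Finset (HeightOneSpectrum (𝓞 (Fp L)))} {f : ℂ → HA L eV dV hdV dW hdW → ℂ}
    {fT : ℂ → UnitaryGroup.arch (Fp L) L (IsCMField.complexConj L) (n + n) (hermD L eV dV hdV dW hdW) ×
      (Π v : ↥T, UnitaryGroup.localPi L (IsCMField.complexConj L) (n + n) (hermD L eV dV hdV dW hdW) v.1) → ℂ}
    (hf : IsFactorizableOff L eV dV hdV dW hdW T χ f fT) (g : HA L eV dV hdV dW hdW) :
    ∃ (U₁ : Finset (HeightOneSpectrum (𝓞 (Fp L)))) (hTU : T ⊆ U₁)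
      (νv : ∀ v : HeightOneSpectrum (𝓞 (Fp L)), Measure ↥(unipDeltaLoc L eB dB hdB dW hdW v)) (_ : ∀ v, (νv v).IsHaarMeasure) (_ : ∀ v, SigmaFinite (νv v))
      (νinf : Finset (HeightOneSpectrum (𝓞 (Fp L))) → Measure ↥(unipDeltaArch L eB dB hdB dW hdW)),
      (∀ T', (νinf T').IsHaarMeasure) ∧ (∀ T', SigmaFinite (νinf T')) ∧
      (∀ v, νv v (((inH (fun v => UnitaryGroup.localInt L (IsCMField.complexConj L) (n₂ + n₂) (hermD L eB dB hdB dW hdW) v)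
        (fun v => unipDeltaLoc L eB dB hdB dW hdW v) v) : Subgroup ↥(unipDeltaLoc L eB dB hdB dW hdW v)) : Set ↥(unipDeltaLoc L eB dB hdB dW hdW v)) = 1) ∧
      (∀ T' : Finset (HeightOneSpectrum (𝓞 (Fp L))), Measure.map (unipDeltaSplitAt L eB dB hdB dW hdW T') (Measure.map nB μ) =
        (νinf T').prod ((Measure.pi fun v : T' => νv v.1).prod
          (rpMeasure (fun v : {v : HeightOneSpectrum (𝓞 (Fp L)) // v ∉ T'} => ((inH (fun v => UnitaryGroup.localInt L (IsCMField.complexConj L) (n₂ + n₂) (hermD L eB dB hdB dW hdW) v)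
            (fun v => unipDeltaLoc L eB dB hdB dW hdW v) v.1 : Subgroup ↥(unipDeltaLoc L eB dB hdB dW hdW v.1)) : Set ↥(unipDeltaLoc L eB dB hdB dW hdW v.1))) (fun v => νv v.1) ∅))) ∧
      (∀ v, v ∉ U₁ → ∀ w' : UnitaryGroup.PlacesOver L v, χ.IsUnramifiedAt w'.1) ∧
      ∀ (Sℓ : Matrix (Fin n₂) (Fin n₂) L), (∀ i, IsCMField.complexConj L (Sℓ i i) = -Sℓ i i) → (∀ i, Sℓ i i ≠ 0) →
      ∀ (h : HA L eB dB hdB dW hdW) (s : ℂ), 0 < s.re →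
        (¬ Integrable (fun u : ↥(unipDelta L eB dB hdB dW hdW) =>
            conj (unipDeltaChar L eB dB hdB dW hdW Sℓ (u : HA L eB dB hdB dW hdW) : ℂ) *
              f s (blkD L eV eA eB dA hdA dB hdB dV hdV hVA hVB dW hdW (1, weylDelta L eB dB hdB dW hdW * (u : HA L eB dB hdB dW hdW) * h) * g)) (Measure.map nB μ) →
          whittakerDelta L eB dB hdB dW hdW (Measure.map nB μ) Sℓ (fun y => f s (blkD L eV eA eB dA hdA dB hdB dV hdV hVA hVB dW hdW (1, y) * g)) h = 0) ∧
        (Integrable (fun u : ↥(unipDelta L eB dB hdB dW hdW) =>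
            conj (unipDeltaChar L eB dB hdB dW hdW Sℓ (u : HA L eB dB hdB dW hdW) : ℂ) *
              f s (blkD L eV eA eB dA hdA dB hdB dV hdV hVA hVB dW hdW (1, weylDelta L eB dB hdB dW hdW * (u : HA L eB dB hdB dW hdW) * h) * g)) (Measure.map nB μ) →
          whittakerDelta L eB dB hdB dW hdW (Measure.map nB μ) Sℓ (fun y => f s (blkD L eV eA eB dA hdA dB hdB dV hdV hVA hVB dW hdW (1, y) * g)) h =
            kindWPart L eB dB hdB dW hdW (kindWFinset L eB dB hdB dW hdW U₁ Sℓ h) (νinf (kindWFinset L eB dB hdB dW hdW U₁ Sℓ h)) νv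
                (fun s' q =>
                  fT (s' - (n₁ : ℂ) / 2) (UnitaryGroup.archPart (Fp L) L (IsCMField.complexConj L) (n + n) (hermD L eV dV hdV dW hdW) (blkD L eV eA eB dA hdA dB hdB dV hdV hVA hVB dW hdW (1, (UnitaryGroup.archToAdelic (Fp L) L (IsCMField.complexConj L) (n₂ + n₂) (hermD L eB dB hdB dW hdW) q.1 : HA L eB dB hdB dW hdW)) * g),
                      fun v : ↥T => UnitaryGroup.evalPlace (Fp L) L (IsCMField.complexConj L) (n + n) (hermD L eV dV hdV dW hdW) v.1 (UnitaryGroup.finPart (Fp L) L (IsCMField.complexConj L) (n + n) (hermD L eV dV hdV dW hdW) (blkD L eV eA eB dA hdA dB hdB dV hdV hVA hVB dW hdW (1, locToAdelic L eB dB hdB dW hdW v.1 (q.2 ⟨v.1, (hTU.trans (subset_kindWFinset L eB dB hdB dW hdW U₁ Sℓ h)) v.2⟩)))) *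
                        UnitaryGroup.evalPlace (Fp L) L (IsCMField.complexConj L) (n + n) (hermD L eV dV hdV dW hdW) v.1 (UnitaryGroup.finPart (Fp L) L (IsCMField.complexConj L) (n + n) (hermD L eV dV hdV dW hdW) g)) *
                    ∏ v ∈ kindWFinset L eB dB hdB dW hdW U₁ Sℓ h \ T, LambdaLoc L eV dV hdV dW hdW v χ (s' - (n₁ : ℂ) / 2)
                      (if hv : v ∈ kindWFinset L eB dB hdB dW hdW U₁ Sℓ h then UnitaryGroup.evalPlace (Fp L) L (IsCMField.complexConj L) (n + n) (hermD L eV dV hdV dW hdW) v (UnitaryGroup.finPart (Fp L) L (IsCMField.complexConj L) (n + n) (hermD L eV dV hdV dW hdW) (blkD L eV eA eB dA hdA dB hdB dV hdV hVA hVB dW hdW (1, locToAdelic L eB dB hdB dW hdW v (q.2 ⟨v, hv⟩)))) * UnitaryGroup.evalPlace (Fp L) L (IsCMField.complexConj L) (n + n) (hermD L eV dV hdV dW hdW) v (UnitaryGroup.finPart (Fp L) L (IsCMField.complexConj L) (n + n) (hermD L eV dV hdV dW hdW) g) else 1))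
                Sℓ (s + (n₁ : ℂ) / 2) h *
              (partialStandardL (kindWPlaces L eB dB hdB dW hdW (U₁ : Set (HeightOneSpectrum (𝓞 (Fp L)))) Sℓ h)
                  (fun v => {(quadraticHeckeCharCM L).valueAtUniformizer v}) (2 * (s + (n₁ : ℂ) / 2) + 1))⁻¹) := by
  haveI : Algebra.IsQuadraticExtension (Fp L) L := IsCMField.isQuadraticExtension L
  -- the line datum has `n₂ = 1`
  obtain rfl : n₂ = 1 := by simpa using (Fintype.card_congr eB).symm
  -- the line chart carries a Haar measure (★ p862728); the KIND-W carriers of `Measure.map nB μ` (★ (KW-car) ED. 2)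
  haveI : (Measure.map nB μ).IsHaarMeasure := isHaarMeasure_map_lineChart L eB dB hdB dW hdW hdB0 hdW0 μ nB hnBc hnBadd hnB
  obtain ⟨T₁, νv, hH, hσv, hνK, νinf, hHinf, hσinf, hmap, hχ⟩ := exists_kindW_carrierLetters_haar L eB dB hdB dW hdW χ (Measure.map nB μ)
  haveI := hH
  haveI := hσv
  -- §1: the rank-one letter `hJ` off `U₁′ ⊇ T ∪ T₁`
  obtain ⟨U₁', hTU₁', hJ⟩ := exists_finset_lineJ L eB dB hdB hdB0 dW hdW hdW0 (T ∪ T₁) νv hνK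
    (fun v hv => hχ v fun hv' => hv (Finset.mem_union_right _ hv')) hε
  -- the good places of the line (★ `eventually_isGoodPlace` at `n = 1`) and the hyperspecial places of `g`, cofinitely
  have hχ' : ∀ᶠ v : HeightOneSpectrum (𝓞 (Fp L)) in cofinite, ∀ w' : UnitaryGroup.PlacesOver L v, χ.IsUnramifiedAt w'.1 :=
    T₁.eventually_cofinite_notMem.mono fun v hv => hχ v hv
  have hgood := LocalSplitting.eventually_isGoodPlace (Fp L) L (imagUnit L) 1 (gramR L eB dB hdB dW hdW) (imagUnit_ne_zero L)
    (isUnit_det_gramR₀ L eB dB hdB hdB0 dW hdW hdW0) (fun v (w : UnitaryGroup.PlacesOver L v) => χ.localComponent w.1)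
    (hχ'.mono fun v hv w u hu => (hv w).localComponent_eq_one_of_valuation_eq_one hu)
  have hgK := UnitaryGroup.eventually_evalPlace_mem_localInt (Fp L) L (IsCMField.complexConj L) (n + n) (hermD L eV dV hdV dW hdW)
    (UnitaryGroup.finPart (Fp L) L (IsCMField.complexConj L) (n + n) (hermD L eV dV hdV dW hdW) g)
  obtain ⟨B, hBspec⟩ : ∃ B : Finset (HeightOneSpectrum (𝓞 (Fp L))), ∀ v, v ∉ B →
      LocalSplitting.IsGoodPlace (Fp L) L (imagUnit L) v 1 (gramR L eB dB hdB dW hdW) (fun w => χ.localComponent w.1) ∧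
      UnitaryGroup.evalPlace (Fp L) L (IsCMField.complexConj L) (n + n) (hermD L eV dV hdV dW hdW) v
        (UnitaryGroup.finPart (Fp L) L (IsCMField.complexConj L) (n + n) (hermD L eV dV hdV dW hdW) g) ∈ UnitaryGroup.localInt L (IsCMField.complexConj L) (n + n) (hermD L eV dV hdV dW hdW) v := by
    refine ⟨(Filter.eventually_cofinite.1 (hgood.and hgK)).toFinset, fun v hv => ?_⟩
    simp only [Set.Finite.mem_toFinset, Set.mem_setOf_eq, not_not] at hv
    exact hv
  have hout : ∀ v, v ∉ U₁' ∪ B → v ∉ U₁' ∧ v ∉ B := fun v hv => by rwa [Finset.mem_union, not_or] at hv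
  -- Siegel-integral decompositions in `H_B(L⁺_v)` at a good place of the line (★ `exists_isSiegelIntDecomp`; `gramR^{(B)}` is `1 × 1`)
  have hIw : ∀ v, v ∉ U₁' ∪ B → ∀ u : UnitaryGroup.localPi L (IsCMField.complexConj L) (1 + 1) (hermD L eB dB hdB dW hdW) v, ∃ pk, IsSiegelIntDecomp L eB dB hdB dW hdW v u pk := by
    intro v hv u
    have hgv := (hBspec v (hout v hv).2).1
    refine exists_isSiegelIntDecomp L eB dB hdB dW hdW v hdB0 hdW0 hgv.two hgv.gram (fun w i j => ?_) u
    obtain rfl : i = 0 := Subsingleton.elim _ _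
    obtain rfl : j = 0 := Subsingleton.elim _ _
    have hdet := hgv.gramDet w
    rw [Matrix.det_fin_one] at hdet
    rw [K2LiuKindOneLineCharacterReading.inv_fin_one_apply (Fp L), map_inv₀, map_inv₀, map_inv₀, hdet, inv_one]
  have hs' : ∀ {s : ℂ}, 0 < s.re → 0 < (s + (n₁ : ℂ) / 2).re := fun {s} hs => by
    have h2 : ((n₁ : ℂ) / 2).re = (n₁ : ℝ) / 2 := by simp
    rw [Complex.add_re, h2]
    positivity
  have hTU : T ⊆ U₁' ∪ B := (Finset.subset_union_left.trans hTU₁').trans Finset.subset_union_left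
  refine ⟨U₁' ∪ B, hTU, νv, hH, hσv, νinf, hHinf, hσinf, hνK, hmap, fun v hv => hχ v fun hv' => (hout v hv).1 (hTU₁' (Finset.mem_union_right _ hv')),
    fun Sℓ hSσ hS0 h s hs => ⟨fun hG => whittakerDelta_eq_zero_of_not_integrable L eB dB hdB dW hdW (Measure.map nB μ) Sℓ _ h hG, fun hG => ?_⟩⟩
  exact whittakerDelta_cornerTranslate_eq_kindWPart_mul_line L eV eA eB dA hdA dB hdB dV hdV hVA hVB dW hdW (U₁' ∪ B) (Measure.map nB μ) νv hνK νinf hσinf hmap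
    (fun v hv => hχ v fun hv' => (hout v hv).1 (hTU₁' (Finset.mem_union_right _ hv'))) hTU hf (fun v hv => (hBspec v (hout v hv).2).2) hIw Sℓ hs h hG
    (fun v hv => hJ Sℓ (hSσ 0) (hS0 0) h (s + (n₁ : ℂ) / 2) (hs' hs) v
      fun hv' => hv (kindWPlaces_mono L eB dB hdB dW hdW (Finset.coe_subset.2 Finset.subset_union_left) Sℓ h hv'))

end Package


end Summit.HodgeConjecture.HodgeConjecture.Cruxes.HLiu418.K2LiuKindOneLineCornerEuler

end
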